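import Literature.NumberTheory.LFunctions.DirichletMVTSharp
import Mathlib.NumberTheory.Harmonic.Bounds
import HarnessLib

/-!
# A crude two-sided mean value theorem for Dirichlet polynomials

Trunk T-ANT (`Literature/NumberTheory/LFunctions`). Proofs only (no definitions, no named facts).
Companion of `DirichletPolynomialMeanValue.lean` / `DirichletMVTSharp.lean`, which PROVE the
one-sided (upper) mean value theorems by Gaussian smoothing and record the sharp two-sided
theorem of Montgomery–Vaughan (Ivić 1985, Thm 5.2, `Ivic1985_theorem52`:
`∫_0^T |∑ a_n n^{it}|² = T ∑|a_n|² + O(∑ n|a_n|²)`) as a named fact. Here we PROVE the elementary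
two-sided form with the weaker off-diagonal bound `O(N log N ∑|a_n|²)`:

* `DirichletMVT.abs_meanSquare_sub_le` : for complex `a_n` and real `T`,
  `|∫_0^T |∑_{n=1}^{N} a_n n^{-it}|² dt − T ∑_{n=1}^{N} |a_n|²| ≤ 4N(1 + log N) ∑_{n=1}^{N} |a_n|²`.

Proof (Titchmarsh, *Theory of the Riemann zeta-function*, §7.2, first step; Ivić §5.1): expand the
square and integrate termwise; the diagonal gives `T ∑|a_n|²`, and for `m ≠ n`
`|∫_0^T (n/m)^{it} dt| ≤ 2/|log(n/m)| ≤ 2N/|n − m|` (`DirichletMVT.abs_sub_div_le_abs_log_sub`,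
from `log y ≥ 1 − 1/y`), so the off-diagonal part is at most
`∑_{m≠n} |a_m a_n| 2N/|n−m| ≤ 2N ∑_n |a_n|² ∑_{m≠n} 1/|n−m| ≤ 4N(1 + log N) ∑|a_n|²` (Young's
inequality with the symmetric kernel, `sum_sum_mul_mul_le_of_symm`, and two harmonic sums,
`DirichletMVT.sum_one_div_abs_sub_le`, harmonic sums via Mathlib's `harmonic_le_one_add_log`). This lossy form suffices whenever the length `N` is small
against `T` up to logarithms, e.g. for the head of Montgomery's Dirichlet series in the proof of his
pair correlation theorem (`MontgomeryCoefficientSums.lean`).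

## References

* E. C. Titchmarsh, *The Theory of the Riemann Zeta-Function*, 2nd ed. (1986), §7.2.
* A. Ivić, *The Riemann Zeta-Function* (1985), §5.1, Thm 5.2.
* H. L. Montgomery, R. C. Vaughan, *Hilbert's inequality*, J. London Math. Soc. (2) 8 (1974), 73–82
  (the sharp form, not proved here).
-/

noncomputable section

open Finset Real MeasureTheory Complex Filter Topology
open scoped ComplexConjugate

namespace Literature.NumberTheory.LFunctions

namespace DirichletMVT

/-! ### Off-diagonal kernel: `|log n − log m| ≥ |n − m|/N` and harmonic row sums -/

/-- For `1 ≤ m ≤ N`, `1 ≤ n ≤ N`: `|n − m|/N ≤ |log n − log m|` (from `log y ≥ 1 − 1/y`). [folklore] -/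
theorem abs_sub_div_le_abs_log_sub {m n N : ℕ} (hm : 1 ≤ m) (hmN : m ≤ N) (hn : 1 ≤ n) (hnN : n ≤ N) :
    |(n : ℝ) - m| / N ≤ |Real.log n - Real.log m| := by
  have hm0 : (0 : ℝ) < m := by exact_mod_cast hm
  have hn0 : (0 : ℝ) < n := by exact_mod_cast hn
  have hN0 : (0 : ℝ) < N := by exact_mod_cast (hm.trans hmN)
  have hmN' : (m : ℝ) ≤ N := by exact_mod_cast hmN
  have hnN' : (n : ℝ) ≤ N := by exact_mod_cast hnN
  -- the key one-sided inequality: for `0 < u ≤ v ≤ N`, `(v - u)/N ≤ log v - log u`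
  have key : ∀ u v : ℝ, 0 < u → u ≤ v → v ≤ N → (v - u) / N ≤ Real.log v - Real.log u := by
    intro u v hu huv hvN
    have hv : 0 < v := lt_of_lt_of_le hu huv
    have h1 : 1 - (v / u)⁻¹ ≤ Real.log (v / u) := Real.one_sub_inv_le_log_of_pos (by positivity)
    rw [Real.log_div hv.ne' hu.ne', inv_div] at h1
    have h2 : (v - u) / N ≤ (v - u) / v := by
      exact div_le_div_of_nonneg_left (by linarith) hv hvN
    have h3 : (v - u) / v = 1 - u / v := by field_simp
    linarith
  rcases le_total (m : ℝ) n with h | h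
  · rw [abs_of_nonneg (by linarith), abs_of_nonneg (by
      linarith [Real.log_le_log hm0 h])]
    exact key _ _ hm0 h hnN'
  · rw [abs_of_nonpos (by linarith), abs_of_nonpos (by
      linarith [Real.log_le_log hn0 h]), neg_sub, neg_sub]
    exact key _ _ hn0 h hmN'

/-- Row sums of the off-diagonal kernel: for `1 ≤ m ≤ N`,
`∑_{1≤n≤N, n≠m} 1/|n − m| ≤ 2(1 + log N)` (two harmonic sums). [folklore] -/
theorem sum_one_div_abs_sub_le {m N : ℕ} (hm : 1 ≤ m) (hmN : m ≤ N) :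
    ∑ n ∈ (Finset.Icc 1 N).filter (fun n ↦ n ≠ m), 1 / |(n : ℝ) - m| ≤ 2 * (1 + Real.log N) := by
  classical
  -- harmonic sums: `∑_{j<J} 1/(j+1) ≤ 1 + log J` (Mathlib's `harmonic_le_one_add_log`)
  have hH : ∑ j ∈ Finset.range N, 1 / ((j : ℝ) + 1) ≤ 1 + Real.log N := by
    have h := harmonic_le_one_add_log N
    have e : ((harmonic N : ℚ) : ℝ) = ∑ j ∈ Finset.range N, 1 / ((j : ℝ) + 1) := by
      rw [harmonic]
      push_cast
      refine Finset.sum_congr rfl fun j _ ↦ ?_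
      rw [one_div]
    rw [e] at h
    exact h
  -- split into `n < m` and `m < n`
  have hsplit : (Finset.Icc 1 N).filter (fun n ↦ n ≠ m) =
      (Finset.Ico 1 m) ∪ (Finset.Ioc m N) := by
    ext n
    simp only [Finset.mem_filter, Finset.mem_Icc, Finset.mem_union, Finset.mem_Ico, Finset.mem_Ioc]
    omega
  have hdisj : Disjoint (Finset.Ico 1 m) (Finset.Ioc m N) := by
    rw [Finset.disjoint_left]
    intro n h1 h2
    rw [Finset.mem_Ico] at h1
    rw [Finset.mem_Ioc] at h2
    omega
  rw [hsplit, Finset.sum_union hdisj]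
  -- the part `m < n ≤ N`: `∑_{j < N - m} 1/(j+1)`
  have h2 : ∑ n ∈ Finset.Ioc m N, 1 / |(n : ℝ) - m| ≤ 1 + Real.log N := by
    have e : ∑ n ∈ Finset.Ioc m N, 1 / |(n : ℝ) - m| =
        ∑ j ∈ Finset.range (N - m), 1 / ((j : ℝ) + 1) := by
      rw [← Finset.Ico_add_one_add_one_eq_Ioc, Finset.sum_Ico_eq_sum_range]
      have hNm : N + 1 - (m + 1) = N - m := by omega
      rw [hNm]
      refine Finset.sum_congr rfl fun j _ ↦ ?_
      congr 1
      push_cast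
      rw [show (m : ℝ) + 1 + j - m = j + 1 by ring, abs_of_pos (by positivity)]
    rw [e]
    refine le_trans ?_ hH
    refine Finset.sum_le_sum_of_subset_of_nonneg (Finset.range_subset_range.2 (by omega))
      fun j _ _ ↦ by positivity
  -- the part `1 ≤ n < m`: `∑_{j < m - 1} 1/(j+1)`
  have h1 : ∑ n ∈ Finset.Ico 1 m, 1 / |(n : ℝ) - m| ≤ 1 + Real.log N := by
    have e : ∑ n ∈ Finset.Ico 1 m, 1 / |(n : ℝ) - m| =
        ∑ j ∈ Finset.range (m - 1), 1 / ((j : ℝ) + 1) := by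
      rw [Finset.sum_Ico_eq_sum_range, ← Finset.sum_range_reflect]
      refine Finset.sum_congr rfl fun j hj ↦ ?_
      rw [Finset.mem_range] at hj
      congr 1
      have hc : ((m - 1 - 1 - j : ℕ) : ℝ) = (m : ℝ) - 2 - j := by
        rw [Nat.cast_sub (by omega), Nat.cast_sub (by omega), Nat.cast_sub (by omega)]
        push_cast; ring
      push_cast
      rw [hc, show (1 : ℝ) + ((m : ℝ) - 2 - j) - m = -((j : ℝ) + 1) by ring, abs_neg,
        abs_of_pos (by positivity)]
    rw [e]
    refine le_trans ?_ hH
    refine Finset.sum_le_sum_of_subset_of_nonneg (Finset.range_subset_range.2 (by omega))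
      fun j _ _ ↦ by positivity
  linarith

/-! ### The oscillatory integrals `∫_0^T (n/m)^{it} dt` -/

/-- `‖∫_0^T e^{itL} dt‖ ≤ 2/|L|` for `L ≠ 0`. [folklore] -/
theorem norm_integral_exp_mul_I_le {L : ℝ} (hL : L ≠ 0) (T : ℝ) :
    ‖∫ t in (0 : ℝ)..T, Complex.exp (((t * L : ℝ) : ℂ) * I)‖ ≤ 2 / |L| := by
  have hc : (L : ℂ) * I ≠ 0 := mul_ne_zero (Complex.ofReal_ne_zero.2 hL) Complex.I_ne_zero
  have e : ∫ t in (0 : ℝ)..T, Complex.exp (((t * L : ℝ) : ℂ) * I) =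
      (Complex.exp ((L : ℂ) * I * T) - 1) / ((L : ℂ) * I) := by
    have h := integral_exp_mul_complex (a := 0) (b := T) hc
    simp only [Complex.ofReal_zero, mul_zero, Complex.exp_zero] at h
    rw [← h]
    refine intervalIntegral.integral_congr fun t _ ↦ ?_
    congr 1
    push_cast
    ring
  rw [e, norm_div, norm_mul, Complex.norm_real, Complex.norm_I, mul_one, Real.norm_eq_abs]
  refine div_le_div_of_nonneg_right ?_ (abs_pos.2 hL).le
  calc ‖Complex.exp ((L : ℂ) * I * T) - 1‖ ≤ ‖Complex.exp ((L : ℂ) * I * T)‖ + ‖(1 : ℂ)‖ :=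
        norm_sub_le _ _
    _ = 2 := by
        rw [show (L : ℂ) * I * T = ((L * T : ℝ) : ℂ) * I by push_cast; ring,
          Complex.norm_exp_ofReal_mul_I, norm_one]
        norm_num

/-! ### The crude two-sided mean value theorem -/

/-- **Crude two-sided mean value theorem for Dirichlet polynomials** (the elementary form of
Ivić 1985, Thm 5.2 / Titchmarsh §7.2: integrate the off-diagonal terms exactly and bound
`|∫_0^T (n/m)^{it} dt| ≤ 2/|log(n/m)| ≤ 2N/|n − m|`, then harmonic sums): for complex `a_n`,
`|∫_0^T |∑_{n=1}^{N} a_n n^{-it}|² dt − T ∑_{n=1}^{N} |a_n|²| ≤ 4N(1 + log N) ∑_{n=1}^{N} |a_n|²`.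
(The sharp form, with `O(∑ n|a_n|²)`, is the Montgomery–Vaughan theorem `Ivic1985_theorem52`,
recorded as a named fact in `DirichletPolynomialMeanValue.lean`.) [folklore] -/
theorem abs_meanSquare_sub_le (a : ℕ → ℂ) (N : ℕ) (T : ℝ) :
    |(∫ t in (0 : ℝ)..T, ‖∑ n ∈ Finset.Icc 1 N, a n * (n : ℂ) ^ (-((t : ℂ) * I))‖ ^ 2) -
        T * ∑ n ∈ Finset.Icc 1 N, ‖a n‖ ^ 2| ≤
      4 * N * (1 + Real.log N) * ∑ n ∈ Finset.Icc 1 N, ‖a n‖ ^ 2 := by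
  classical
  set s := Finset.Icc 1 N with hs
  -- the phases
  set e : ℕ → ℝ → ℂ := fun n t ↦ Complex.exp ((-(t * Real.log n) : ℝ) * I) with he
  have hDe : ∀ t : ℝ, ∑ n ∈ s, a n * (n : ℂ) ^ (-((t : ℂ) * I)) = ∑ n ∈ s, a n * e n t := by
    intro t
    refine Finset.sum_congr rfl fun n hn ↦ ?_
    rw [hs, Finset.mem_Icc] at hn
    rw [natCast_cpow_neg_mul_I (by omega)]
  simp_rw [hDe]
  -- the pair phases `E m n t = e_m(t) conj(e_n(t)) = exp(i t (log n - log m))`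
  set E : ℕ → ℕ → ℝ → ℂ := fun m n t ↦
    Complex.exp (((t * (Real.log n - Real.log m) : ℝ) : ℂ) * I) with hE
  have heE : ∀ m n t, e m t * conj (e n t) = E m n t := by
    intro m n t
    simp only [he, hE]
    rw [conj_exp_ofReal_mul_I, ← Complex.exp_add]
    congr 1
    push_cast
    ring
  have hEcont : ∀ m n, Continuous (E m n) := by
    intro m n; simp only [hE]; fun_prop
  -- the integrals `J m n = ∫_0^T E m n`
  set J : ℕ → ℕ → ℂ := fun m n ↦ ∫ t in (0 : ℝ)..T, E m n t with hJ
  have hJdiag : ∀ m, J m m = T := by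
    intro m
    simp only [hJ, hE, sub_self, mul_zero, Complex.ofReal_zero, zero_mul, Complex.exp_zero]
    simp
  have hJoff : ∀ m ∈ s, ∀ n ∈ s, m ≠ n → ‖J m n‖ ≤ 2 * N / |(n : ℝ) - m| := by
    intro m hm n hn hmn
    rw [hs, Finset.mem_Icc] at hm hn
    have hL : Real.log n - Real.log m ≠ 0 := by
      intro h
      have : (n : ℝ) = m := by
        have := Real.log_injOn_pos (Set.mem_Ioi.2 (by exact_mod_cast hn.1 : (0 : ℝ) < n))
          (Set.mem_Ioi.2 (by exact_mod_cast hm.1 : (0 : ℝ) < m)) (sub_eq_zero.1 h)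
        exact this
      exact hmn (by exact_mod_cast this.symm)
    have h1 : ‖J m n‖ ≤ 2 / |Real.log n - Real.log m| := norm_integral_exp_mul_I_le hL T
    have h2 : |(n : ℝ) - m| / N ≤ |Real.log n - Real.log m| :=
      abs_sub_div_le_abs_log_sub hm.1 hm.2 hn.1 hn.2
    have hnm : 0 < |(n : ℝ) - m| := abs_pos.2 (sub_ne_zero.2 (by exact_mod_cast hmn.symm))
    have hN : (0 : ℝ) < N := by exact_mod_cast (hm.1.trans hm.2)
    calc ‖J m n‖ ≤ 2 / |Real.log n - Real.log m| := h1
      _ ≤ 2 / (|(n : ℝ) - m| / N) :=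
          div_le_div_of_nonneg_left (by norm_num) (by positivity) h2
      _ = 2 * N / |(n : ℝ) - m| := by field_simp
  -- Step 1: the mean square as a double sum, in `ℂ`
  have hI : (((∫ t in (0 : ℝ)..T, ‖∑ n ∈ s, a n * e n t‖ ^ 2 : ℝ) : ℝ) : ℂ) =
      ∑ m ∈ s, ∑ n ∈ s, a m * conj (a n) * J m n := by
    rw [← intervalIntegral.integral_ofReal]
    have hpt : ∀ t : ℝ, (((‖∑ n ∈ s, a n * e n t‖ ^ 2 : ℝ) : ℝ) : ℂ) =
        ∑ m ∈ s, ∑ n ∈ s, a m * conj (a n) * E m n t := by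
      intro t
      rw [ofReal_norm_sq_sum_eq]
      refine Finset.sum_congr rfl fun m _ ↦ Finset.sum_congr rfl fun n _ ↦ ?_
      rw [map_mul, ← heE]
      ring
    simp_rw [hpt]
    have hint : ∀ m n, IntervalIntegrable (fun t ↦ a m * conj (a n) * E m n t) volume 0 T :=
      fun m n ↦ (continuous_const.mul (hEcont m n)).intervalIntegrable _ _
    have hint2 : ∀ m : ℕ, IntervalIntegrable (fun t ↦ ∑ n ∈ s, a m * conj (a n) * E m n t)
        volume 0 T := by
      intro m
      have hc : Continuous fun t ↦ ∑ n ∈ s, a m * conj (a n) * E m n t :=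
        continuous_finsetSum s fun n _ ↦ continuous_const.mul (hEcont m n)
      exact hc.intervalIntegrable _ _
    rw [intervalIntegral.integral_finsetSum fun m _ ↦ hint2 m]
    refine Finset.sum_congr rfl fun m _ ↦ ?_
    rw [intervalIntegral.integral_finsetSum fun n _ ↦ hint m n]
    refine Finset.sum_congr rfl fun n _ ↦ ?_
    simp only [hJ]
    rw [intervalIntegral.integral_const_mul]
  -- Step 2: split off the diagonal
  have hsplit : ∑ m ∈ s, ∑ n ∈ s, a m * conj (a n) * J m n =
      (T : ℂ) * ∑ n ∈ s, (((‖a n‖ ^ 2 : ℝ) : ℝ) : ℂ) +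
        ∑ m ∈ s, ∑ n ∈ s.erase m, a m * conj (a n) * J m n := by
    rw [Finset.mul_sum, ← Finset.sum_add_distrib]
    refine Finset.sum_congr rfl fun m hm ↦ ?_
    rw [← Finset.add_sum_erase s _ hm, hJdiag, Complex.mul_conj, Complex.normSq_eq_norm_sq]
    push_cast
    ring
  -- Step 3: the difference is the off-diagonal sum
  have hdiff : ((((∫ t in (0 : ℝ)..T, ‖∑ n ∈ s, a n * e n t‖ ^ 2) -
      T * ∑ n ∈ s, ‖a n‖ ^ 2 : ℝ) : ℝ) : ℂ) = ∑ m ∈ s, ∑ n ∈ s.erase m, a m * conj (a n) * J m n := by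
    push_cast
    rw [hI, hsplit]
    push_cast
    ring
  -- Step 4: the symmetric kernel and its row sums
  set K : ℕ → ℕ → ℝ := fun m n ↦ if m = n then 0 else 2 * N / |(n : ℝ) - m| with hK
  have hKsymm : ∀ m n, K m n = K n m := by
    intro m n
    simp only [hK]
    by_cases h : m = n
    · simp [h]
    · rw [if_neg h, if_neg (Ne.symm h), abs_sub_comm]
  have hK0 : ∀ m n, 0 ≤ K m n := by
    intro m n; simp only [hK]; split_ifs <;> positivity
  have hrow : ∀ n ∈ s, ∑ m ∈ s, K m n ≤ 4 * N * (1 + Real.log N) := by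
    intro n hn
    rw [hs, Finset.mem_Icc] at hn
    have e1 : ∑ m ∈ s, K m n = ∑ m ∈ s.filter (fun m ↦ m ≠ n), 2 * N / |(n : ℝ) - m| := by
      rw [Finset.sum_filter]
      refine Finset.sum_congr rfl fun m _ ↦ ?_
      simp only [hK, ite_not]
    have e2 : ∑ m ∈ s.filter (fun m ↦ m ≠ n), 2 * N / |(n : ℝ) - m| =
        2 * N * ∑ m ∈ s.filter (fun m ↦ m ≠ n), 1 / |(m : ℝ) - n| := by
      rw [Finset.mul_sum]
      refine Finset.sum_congr rfl fun m _ ↦ ?_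
      rw [abs_sub_comm]; ring
    rw [e1, e2]
    have h := sum_one_div_abs_sub_le hn.1 hn.2
    have hN : (0 : ℝ) ≤ N := Nat.cast_nonneg N
    nlinarith
  -- Step 5: the bound
  rw [← Real.norm_eq_abs, ← Complex.norm_real, hdiff]
  calc ‖∑ m ∈ s, ∑ n ∈ s.erase m, a m * conj (a n) * J m n‖
      ≤ ∑ m ∈ s, ∑ n ∈ s.erase m, ‖a m‖ * ‖a n‖ * K m n := by
        refine norm_sum_le_of_le _ fun m hm ↦ norm_sum_le_of_le _ fun n hn ↦ ?_
        obtain ⟨hnm, hn'⟩ := Finset.mem_erase.1 hn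
        rw [norm_mul, norm_mul, Complex.norm_conj]
        have hKmn : K m n = 2 * N / |(n : ℝ) - m| := by simp only [hK, if_neg (Ne.symm hnm)]
        rw [hKmn]
        exact mul_le_mul_of_nonneg_left (hJoff m hm n hn' (Ne.symm hnm)) (by positivity)
    _ = ∑ m ∈ s, ∑ n ∈ s, ‖a m‖ * ‖a n‖ * K m n := by
        refine Finset.sum_congr rfl fun m hm ↦ ?_
        refine Finset.sum_erase s ?_
        simp only [hK, if_true, mul_zero]
    _ ≤ ∑ n ∈ s, ‖a n‖ ^ 2 * ∑ m ∈ s, K m n :=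
        sum_sum_mul_mul_le_of_symm s (fun n ↦ ‖a n‖) K hKsymm hK0
    _ ≤ ∑ n ∈ s, ‖a n‖ ^ 2 * (4 * N * (1 + Real.log N)) :=
        Finset.sum_le_sum fun n hn ↦ mul_le_mul_of_nonneg_left (hrow n hn) (sq_nonneg _)
    _ = 4 * N * (1 + Real.log N) * ∑ n ∈ s, ‖a n‖ ^ 2 := by
        rw [← Finset.sum_mul]; ring

end DirichletMVT

end Literature.NumberTheory.LFunctions
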